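import Mathlib
import Literature.LinearAlgebra.Matrix.SymmetricDetMod2

/-!
# The bipartite (doubled) matrix of a weighted digraph: ambient form, minors, contraction

Set-up for the bipartite all-minors matrix-forest formula
(`Literature/LinearAlgebra/Matrix/BipartiteForestFormula.lean`).  For arc weights
`a : V → V → 𝔽₂` (`a i j` = weight of the arc `i → j`; the diagonal is ignored), a finite vertex set
`D ⊆ V` and "root weights" `ℓ : V → 𝔽₂`, the Laplacian-type matrix `P = L_D + D_ℓ` has entries
`P i j = a i j` (`i ≠ j ∈ D`) and `P i i = ℓ i + Σ_{k ∈ D ∖ i} a i k` (zero row sums when `ℓ = 0`: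
Chaiken's convention [Chaiken1982, §2], Chebotarev–Agaev's `L = D − W` up to sign, which is
immaterial over `𝔽₂` [ChebotarevAgaev2002, §3]).  The **doubled matrix** on `V ⊕ V` is the
symmetric block matrix `N = [[D_y, Pᵀ], [P, D_z]]` (Smith's `M₁ = [[A + Aᵀ, Aᵀ], [A, D_z]]` is
congruent to the case `y = z = ℓ`, see the forest-formula file).  We realise everything as
matrices on the FIXED index type `V ⊕ V` (vertices outside `D` carry unit rows and columns), so
that deleting a vertex, unitizing a row/column (`unitize`) and contracting an arc are identities
between matrices of one type:
* `unitize_unitize_bigN` — deleting both copies of `s ∈ D` gives the doubled matrix of `D ∖ s`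
  with root weights shifted by the arcs into `s` (`ℓ + a • s`);
* `contract_bigN` — the transvection congruence "add row/column `inl s` to `inl j`" followed by
  deletion of `s` gives the doubled matrix of the CONTRACTED weights `a / (s → j)`
  (arcs `k → j` absorb `k → s`) with marks `y + y_s e_j`;
* `det_bigN_zero_zero` — at `y = z = 0` the determinant is `det P` (row permutation to a block
  triangular matrix; `x² = x` in `𝔽₂`);
* the two determinant recursions `det_bigN_rec` (peel the root copy `inr s`: Smith's involution
  remark + contraction) and `det_unitize_bigN_rec` (peel the mark copy `inl s`).
-/

namespace Literature.LinearAlgebra.Matrix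

open _root_.Matrix Finset

variable {V : Type*} [Fintype V] [DecidableEq V]

/-- The Laplacian-type block `P = L_D + D_ℓ` of the arc weights `a` on the vertex set `D`, as an
ambient `V × V` matrix vanishing outside `D × D`: `P i j = a i j` for `i ≠ j`, `P i i = ℓ i +
Σ_{k ∈ D ∖ i} a i k`. [cite: Chaiken1982, §2 (the matrix of the all minors matrix tree theorem, zero row sums)] -/
def lapIn (a : V → V → ZMod 2) (D : Finset V) (ℓ : V → ZMod 2) : Matrix V V (ZMod 2) :=
  of fun i j => if i ∈ D ∧ j ∈ D then (if i = j then ℓ i + ∑ k ∈ D.erase i, a i k else a i j) else 0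

/-- The same block completed by the identity outside `D` (so that its determinant is the
determinant of the `D × D` block). [cite: Chaiken1982, §2] -/
def lap (a : V → V → ZMod 2) (D : Finset V) (ℓ : V → ZMod 2) : Matrix V V (ZMod 2) :=
  of fun i j => if i ∈ D ∧ j ∈ D then (if i = j then ℓ i + ∑ k ∈ D.erase i, a i k else a i j)
    else (if i = j then 1 else 0)

/-- The **doubled (bipartite) matrix** `N = [[D_y, Pᵀ], [P, D_z]]` on `V ⊕ V` (unit rows/columns
outside `D`). [cite: Smith2016CongruentDensity, §2 Thm. 2.2 / Prop. 2.4 (the matrix `M₁ = [[A + Aᵀ, Aᵀ],[A, D_z]]`, to which `N` is congruent)] -/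
def bigN (a : V → V → ZMod 2) (D : Finset V) (y z ℓ : V → ZMod 2) :
    Matrix (V ⊕ V) (V ⊕ V) (ZMod 2) :=
  fromBlocks (diagonal fun i => if i ∈ D then y i else 1) (lapIn a D ℓ)ᵀ (lapIn a D ℓ)
    (diagonal fun i => if i ∈ D then z i else 1)

omit [Fintype V] in
/-- Entries of `lapIn`. [cite: Chaiken1982, §2] -/
theorem lapIn_apply (a : V → V → ZMod 2) (D : Finset V) (ℓ : V → ZMod 2) (i j : V) :
    lapIn a D ℓ i j =
      if i ∈ D ∧ j ∈ D then (if i = j then ℓ i + ∑ k ∈ D.erase i, a i k else a i j) else 0 := rfl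

omit [Fintype V] in
/-- Entries of `lap`. [cite: Chaiken1982, §2] -/
theorem lap_apply (a : V → V → ZMod 2) (D : Finset V) (ℓ : V → ZMod 2) (i j : V) :
    lap a D ℓ i j = if i ∈ D ∧ j ∈ D then (if i = j then ℓ i + ∑ k ∈ D.erase i, a i k else a i j)
      else (if i = j then 1 else 0) := rfl

omit [Fintype V] in
/-- Entries of the doubled matrix, block by block. [cite: Smith2016CongruentDensity, §2 Prop. 2.4] -/
theorem bigN_inl_inl (a : V → V → ZMod 2) (D : Finset V) (y z ℓ : V → ZMod 2) (i j : V) :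
    bigN a D y z ℓ (Sum.inl i) (Sum.inl j) = if i = j then (if i ∈ D then y i else 1) else 0 := by
  simp only [bigN, fromBlocks_apply₁₁, diagonal_apply]

omit [Fintype V] in
/-- Entries of the doubled matrix, block by block. [cite: Smith2016CongruentDensity, §2 Prop. 2.4] -/
theorem bigN_inr_inr (a : V → V → ZMod 2) (D : Finset V) (y z ℓ : V → ZMod 2) (i j : V) :
    bigN a D y z ℓ (Sum.inr i) (Sum.inr j) = if i = j then (if i ∈ D then z i else 1) else 0 := by
  simp only [bigN, fromBlocks_apply₂₂, diagonal_apply]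

omit [Fintype V] in
/-- Entries of the doubled matrix, block by block. [cite: Smith2016CongruentDensity, §2 Prop. 2.4] -/
theorem bigN_inr_inl (a : V → V → ZMod 2) (D : Finset V) (y z ℓ : V → ZMod 2) (i j : V) :
    bigN a D y z ℓ (Sum.inr i) (Sum.inl j) = lapIn a D ℓ i j := by
  simp only [bigN, fromBlocks_apply₂₁]

omit [Fintype V] in
/-- Entries of the doubled matrix, block by block. [cite: Smith2016CongruentDensity, §2 Prop. 2.4] -/
theorem bigN_inl_inr (a : V → V → ZMod 2) (D : Finset V) (y z ℓ : V → ZMod 2) (i j : V) :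
    bigN a D y z ℓ (Sum.inl i) (Sum.inr j) = lapIn a D ℓ j i := by
  simp only [bigN, fromBlocks_apply₁₂, transpose_apply]

omit [Fintype V] in
/-- The doubled matrix is symmetric. [cite: Smith2016CongruentDensity, §2.1 (chunk p0006 L44: "as M is symmetric")] -/
theorem bigN_transpose (a : V → V → ZMod 2) (D : Finset V) (y z ℓ : V → ZMod 2) :
    (bigN a D y z ℓ)ᵀ = bigN a D y z ℓ := by
  rw [bigN, fromBlocks_transpose, transpose_transpose, diagonal_transpose, diagonal_transpose]

omit [Fintype V] in
/-- `unitize` at two different indices commutes. [cite: ChebotarevAgaev2002, §3 Thm. 2] -/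
theorem unitize_comm {R : Type*} [CommRing R] {n : Type*} [DecidableEq n] (N : Matrix n n R)
    (u v : n) : unitize (unitize N u) v = unitize (unitize N v) u := by
  ext i j
  simp only [unitize_apply]
  by_cases hiu : i = u <;> by_cases hiv : i = v <;> by_cases hju : j = u <;> by_cases hjv : j = v <;>
    simp_all

omit [Fintype V] in
/-- Entries of a double unitization. [cite: ChebotarevAgaev2002, §3 Thm. 2] -/
theorem unitize_unitize_apply {R : Type*} [CommRing R] {n : Type*} [DecidableEq n]
    (N : Matrix n n R) (u v i j : n) :
    unitize (unitize N u) v i j =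
      if j = u ∨ j = v then (if i = j then 1 else 0) else (if i = u ∨ i = v then 0 else N i j) := by
  simp only [unitize_apply]
  by_cases hiu : i = u <;> by_cases hiv : i = v <;> by_cases hju : j = u <;> by_cases hjv : j = v <;>
    simp_all

omit [Fintype V] in
/-- Deleting `s`: the Laplacian-type block of `D ∖ s` with root weights `ℓ + a • s` agrees with
that of `D` away from `s`. [cite: Chaiken1982, §2] -/
theorem lapIn_erase (a : V → V → ZMod 2) {D : Finset V} {s : V} (hs : s ∈ D) (ℓ : V → ZMod 2)
    {i j : V} (hi : i ≠ s) (hj : j ≠ s) :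
    lapIn a (D.erase s) (fun k => ℓ k + a k s) i j = lapIn a D ℓ i j := by
  rw [lapIn_apply, lapIn_apply]
  simp only [mem_erase, ne_eq, hi, hj, not_false_eq_true, true_and]
  by_cases hij : i = j
  · subst hij
    by_cases hiD : i ∈ D
    · have hsum : ∑ k ∈ D.erase i, a i k = a i s + ∑ k ∈ (D.erase s).erase i, a i k := by
        rw [← add_sum_erase (D.erase i) _ (mem_erase.mpr ⟨Ne.symm hi, hs⟩), erase_right_comm]
      simp only [hiD, and_self, if_true, hsum]
      ring
    · simp [hiD]
  · simp only [hij, if_false]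

/-- The contracted arc weights `a / (s → j)`: every arc `k → j` absorbs the arc `k → s`
(`a' k j = a k j + a k s`), all other arcs unchanged. [cite: Chaiken1982, §2 (contraction of an edge in the inductive proof)] -/
def contractWt (a : V → V → ZMod 2) (s j : V) : V → V → ZMod 2 :=
  fun k i => if i = j then a k j + a k s else a k i

omit [Fintype V] in
/-- Entries of the contracted weights. [cite: Chaiken1982, §2] -/
theorem contractWt_apply (a : V → V → ZMod 2) (s j k i : V) :
    contractWt a s j k i = if i = j then a k j + a k s else a k i := rfl

omit [Fintype V] in
/-- Off the column `j` the contracted weights are the old ones. [cite: Chaiken1982, §2] -/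
theorem contractWt_of_ne (a : V → V → ZMod 2) (s j k : V) {i : V} (hi : i ≠ j) :
    contractWt a s j k i = a k i := by
  rw [contractWt_apply, if_neg hi]

omit [Fintype V] in
/-- Diagonal sums of the contracted weights over a set avoiding `s`: the arc into `s` is
re-attributed to `j`. [cite: Chaiken1982, §2] -/
theorem sum_contractWt_erase (a : V → V → ZMod 2) {D : Finset V} {s j k : V} (hs : s ∈ D)
    (hj : j ∈ D) (hjs : j ≠ s) (hks : k ≠ s) (hkj : k ≠ j) :
    ∑ m ∈ (D.erase s).erase k, contractWt a s j k m = ∑ m ∈ D.erase k, a k m := by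
  have hjm : j ∈ (D.erase s).erase k := mem_erase.mpr ⟨hkj.symm, mem_erase.mpr ⟨hjs, hj⟩⟩
  have hsm : s ∈ D.erase k := mem_erase.mpr ⟨hks.symm, hs⟩
  rw [← add_sum_erase _ _ hjm, ← add_sum_erase _ _ hsm, contractWt_apply, if_pos rfl]
  have hjm' : j ∈ (D.erase k).erase s := mem_erase.mpr ⟨hjs, mem_erase.mpr ⟨hkj.symm, hj⟩⟩
  rw [← add_sum_erase _ _ hjm']
  have hset : ((D.erase s).erase k).erase j = ((D.erase k).erase s).erase j := by
    rw [erase_right_comm (a := s) (b := k)]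
  rw [hset, sum_congr rfl fun m hm => contractWt_of_ne a s j k (ne_of_mem_erase hm)]
  ring

omit [Fintype V] in
/-- Contracting `s → j`: the Laplacian-type block of the contracted weights on `D ∖ s` is obtained
from that of `D` by adding column `s` to column `j` (away from `s`). [cite: Chaiken1982, §2] -/
theorem lapIn_contract (a : V → V → ZMod 2) {D : Finset V} {s j : V} (hs : s ∈ D) (hj : j ∈ D)
    (hjs : j ≠ s) (ℓ : V → ZMod 2) {k i : V} (hk : k ≠ s) (hi : i ≠ s) :
    lapIn (contractWt a s j) (D.erase s) ℓ k i =
      lapIn a D ℓ k i + (if i = j then lapIn a D ℓ k s else 0) := by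
  have h2 : ∀ x : ZMod 2, x + x = 0 := fun x => CharTwo.add_self_eq_zero x
  rw [lapIn_apply, lapIn_apply, lapIn_apply]
  simp only [mem_erase, ne_eq, hk, hi, hs, not_false_eq_true, true_and, and_true, if_false]
  by_cases hkD : k ∈ D
  · by_cases hiD : i ∈ D
    · rw [if_pos (And.intro hkD hiD), if_pos (And.intro hkD hiD), if_pos hkD]
      by_cases hki : k = i
      · subst hki
        rw [if_pos rfl, if_pos rfl]
        by_cases hkj : k = j
        · subst hkj
          rw [if_pos rfl, sum_congr rfl fun m hm => contractWt_of_ne a s k k (ne_of_mem_erase hm),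
            ← add_sum_erase (D.erase k) (fun m => a k m) (mem_erase.mpr ⟨Ne.symm hk, hs⟩),
            erase_right_comm]
          linear_combination (-1 : ZMod 2) * h2 (a k s)
        · rw [if_neg hkj, add_zero, sum_contractWt_erase a hs hj hjs hk hkj]
      · rw [if_neg hki, if_neg hki]
        by_cases hij : i = j
        · subst hij; rw [if_pos rfl, contractWt_apply, if_pos rfl]
        · rw [if_neg hij, contractWt_of_ne a s j k hij, add_zero]
    · rw [if_neg (fun h => hiD h.2), if_neg (fun h => hiD h.2), zero_add]
      by_cases hij : i = j
      · exact absurd (hij ▸ hj) hiD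
      · rw [if_neg hij]
  · rw [if_neg (fun h => hkD h.1), if_neg (fun h => hkD h.1), if_neg hkD, zero_add]
    split_ifs <;> rfl

set_option linter.unusedSimpArgs false in -- shared simp sets across case splits
omit [Fintype V] in
/-- **Deleting a vertex.** Unitizing both copies `inl s`, `inr s` of `s ∈ D` in the doubled matrix
of `D` gives the doubled matrix of `D ∖ s` with root weights shifted by the arcs into `s`:
`ℓ ↦ ℓ + a • s`. [cite: Chaiken1982, §2 (deleting a root row and column)] -/
theorem unitize_unitize_bigN (a : V → V → ZMod 2) {D : Finset V} {s : V} (hs : s ∈ D)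
    (y z ℓ : V → ZMod 2) :
    unitize (unitize (bigN a D y z ℓ) (Sum.inl s)) (Sum.inr s) =
      bigN a (D.erase s) y z (fun i => ℓ i + a i s) := by
  have hsD : s ∉ D.erase s := notMem_erase s D
  ext (i | i) (j | j) <;> rw [unitize_unitize_apply]
  · rw [bigN_inl_inl, bigN_inl_inl]
    by_cases hj : j = s
    · subst hj; by_cases hij : i = j <;> simp [hij, hsD]
    · by_cases hi : i = s
      · subst hi; simp [hj, Ne.symm hj]
      · simp [hi, hj, mem_erase]
  · rw [bigN_inl_inr, bigN_inl_inr]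
    by_cases hj : j = s
    · subst hj; simp [lapIn_apply, hsD]
    · by_cases hi : i = s
      · subst hi; simp [lapIn_apply, hsD, hj]
      · simp [hi, hj, lapIn_erase a hs ℓ hj hi]
  · rw [bigN_inr_inl, bigN_inr_inl]
    by_cases hj : j = s
    · subst hj; simp [lapIn_apply, hsD]
    · by_cases hi : i = s
      · subst hi; simp [lapIn_apply, hsD, hj]
      · simp [hi, hj, lapIn_erase a hs ℓ hi hj]
  · rw [bigN_inr_inr, bigN_inr_inr]
    by_cases hj : j = s
    · subst hj; by_cases hij : i = j <;> simp [hij, hsD]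
    · by_cases hi : i = s
      · subst hi; simp [hj, Ne.symm hj]
      · simp [hi, hj, mem_erase]

set_option linter.unusedSimpArgs false in -- shared simp sets across case splits
omit [Fintype V] in
/-- **Contracting an arc.** For `s ≠ j` in `D`: adding row/column `inl s` to row/column `inl j`
of the doubled matrix (`rowColAdd`) and then deleting both copies of `s` yields the doubled
matrix of `D ∖ s` for the contracted weights `a / (s → j)` and the merged marks
`y + y s · e_j`. [cite: Chaiken1982, §2 (contraction step of the inductive proof of the all minors matrix tree theorem)] -/
theorem contract_bigN (a : V → V → ZMod 2) {D : Finset V} {s j : V} (hs : s ∈ D) (hj : j ∈ D)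
    (hjs : j ≠ s) (y z ℓ : V → ZMod 2) :
    unitize (unitize (rowColAdd (bigN a D y z ℓ) (Sum.inl j) (Sum.inl s)) (Sum.inl s)) (Sum.inr s) =
      bigN (contractWt a s j) (D.erase s) (fun i => if i = j then y j + y s else y i) z ℓ := by
  have hsD : s ∉ D.erase s := notMem_erase s D
  ext (i | i) (k | k) <;> rw [unitize_unitize_apply]
  · -- top-left
    rw [bigN_inl_inl]
    by_cases hk : k = s
    · subst hk; by_cases hik : i = k <;> simp [hik, hsD]
    · by_cases hi : i = s
      · subst hi; simp [hk, Ne.symm hk]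
      · simp only [hi, hk, Sum.inl.injEq, reduceCtorEq, or_self, if_false, rowColAdd_apply,
          bigN_inl_inl, mem_erase]
        by_cases hij : i = j
        · subst hij
          by_cases hik : i = k
          · subst hik; simp [hs, hj, Ne.symm hi, hi]
          · simp [hik, Ne.symm hik, Ne.symm hi, hi, hk, Ne.symm hk]
        · by_cases hik : i = k
          · subst hik; simp [hij, Ne.symm hi, hi]
          · by_cases hkj : k = j
            · subst hkj; simp [hij, hik, hi, hk, Ne.symm hi, Ne.symm hk, Ne.symm hik]
            · simp [hij, hik, hkj, hk, hi, Ne.symm hk, Ne.symm hi]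
  · -- top-right: `(inl i, inr k) = P' k i`
    rw [bigN_inl_inr]
    by_cases hk : k = s
    · subst hk; simp [lapIn_apply, hsD]
    · by_cases hi : i = s
      · subst hi; simp [lapIn_apply, hsD, hk]
      · simp only [hi, hk, Sum.inl.injEq, reduceCtorEq, or_self, if_false, rowColAdd_apply,
          bigN_inl_inr, false_or, add_zero]
        rw [lapIn_contract a hs hj hjs ℓ hk hi]
        by_cases hij : i = j
        · subst hij; simp [hk, hi]
        · simp [hij, hk, hi]
  · -- bottom-left: `(inr i, inl k) = P' i k`
    rw [bigN_inr_inl]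
    by_cases hk : k = s
    · subst hk; simp [lapIn_apply, hsD]
    · by_cases hi : i = s
      · subst hi; simp [lapIn_apply, hsD, hk]
      · simp only [hi, hk, Sum.inr.injEq, Sum.inl.injEq, reduceCtorEq, or_self, if_false,
          rowColAdd_apply, bigN_inr_inl, zero_add]
        rw [lapIn_contract a hs hj hjs ℓ hi hk]
  · -- bottom-right
    rw [bigN_inr_inr]
    by_cases hk : k = s
    · subst hk; by_cases hik : i = k <;> simp [hik, hsD]
    · by_cases hi : i = s
      · subst hi; simp [hk, Ne.symm hk]
      · simp only [hi, hk, Sum.inr.injEq, reduceCtorEq, or_self, if_false, rowColAdd_apply,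
          bigN_inr_inr, add_zero, mem_erase]
        by_cases hik : i = k <;> simp [hik, hi, hk]

end Literature.LinearAlgebra.Matrix
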